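import Literature.NumberTheory.EllipticCurves.HeegnerPointsShimuraReciprocityHoldsProofs
import Literature.NumberTheory.EllipticCurves.HeegnerPointsShimuraReciprocityProofs
import Literature.NumberTheory.EllipticCurves.HeegnerPointsOfConductorOneData
import Literature.NumberTheory.EllipticCurves.ModularParametrizationDegree
import HarnessLib

set_option linter.dupNamespace false
set_option autoImplicit false

/-!
# LINE B49, family F3: Shimura reciprocity READ IN `K[1]`, the conductor-`1` point `y(1)` as a member of the lifted family,
# and the genus character on `Gal(K[1]/K)` (`σ√−ℓ = √−ℓ ⟺ σ` is a square)

Cell `bsd-goldfeld`, seat `bsd-goldfeld-s1p-c3x` (prover, gen 0; second lane on item `stmt-BirchSwinnertonDyer-19350`, instruction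
of record `HOME/LANE-BRIEF-S1P-C3X.md` §2 file 4, Gross half, first part), `--supports stmt-BirchSwinnertonDyer-19350`. Theses-free;
theorems only; NO definition, NO fact; nothing restated: Shimura reciprocity is CONSUMED through ty's PROVED
`heegnerPoints_shimuraReciprocity_holds` (Darmon Thm 3.6–3.7 over the field of singular moduli `H_K ⊂ ℂ`). HONEST FRAMING:
bookkeeping only; BSD is not touched.

## Content

§1 **Transport `H_K = K[1]`.** The tree has two names for the Hilbert class field inside `ℂ`: `singularModuliField K ι` (ty's
files) and `ringClassField K ι 1` (the Kolyvagin–Heegner data of Gross 1991, seat c3's trace relation, the height ratio (H5) and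
the assembly of THEOREM A″); they are EQUAL subfields (`ringClassField_one`). `exists_shimuraReciprocity_ringClassField_one`
re-reads the lift family `P_Q ∈ E(H_K)` and the Artin isomorphism `θ : Cl(𝒪_{d_K}) ≃ Gal(H_K/K)` with its translation law in
`E(K[1])` / `Gal(K[1]/K)` (inclusions both ways, `AlgEquiv.autCongr`).
§2 **`y(1)` is a member of the family**: the conductor-`1` point `d.y ∈ E(K[1])` of a Kolyvagin–Heegner datum maps to `φ(τ_{Q₁})`,
`Q₁ = ((β² − d_K)/4, β, 1)`, which is `Γ₀(N)`-equivalent to a representative `q₁ ∈ H.reps` (`HeegnerDatum.exists_isGamma0Equiv`),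
and `φ` is `Γ₀(N)`-invariant (`φ_gamma0_smul_holds'`): `d.y = P_{q₁}` (`exists_rep_y_eq_of_kolyvaginHeegnerData`).
§3 **The genus character on the Galois side.** For a finite Galois `L/K`, an isomorphism `Θ : G ≃* Gal(L/K)` from a commutative
group with `[G : G²] = 2`, and `r₀ ∈ L` with `r₀² = d ∈ K` NOT a square in `K`: `σ r₀ = r₀ ⟺ Θ⁻¹σ ∈ G²` (squares fix `r₀`;
`r₀ ∉ K` gives a `σ₀` moving `r₀`; index `2`). For `K = ℚ(√−2ℓ)`, `r₀ = √−ℓ`, `G = Cl(𝒪_{−8ℓ})` this says: the classes whose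
Artin symbol moves `√−ℓ` form the non-principal genus (Cox Thm 3.15 / §6.A: the genus field is cut out by the squares).

References: H. Darmon, CBMS 101 (2004) Thm 3.6–3.7 [Darmon2004]; B. Gross, in LMS LN 153 (1991) §§3–4 [GrossLMS1991];
D. Cox, *Primes of the form x² + ny²* (2013) Thm 3.15, Thm 6.1, Thm 11.1 [Cox2013].
-/

noncomputable section

open scoped Classical

open WeierstrassCurve Literature.NumberTheory.EllipticCurves Literature.NumberTheory.EllipticCurves.ModularForms
  Literature.Computability.Cryptography.Hallgren2005

namespace Summit.BirchSwinnertonDyer.BirchSwinnertonDyer.Theorems.GoldfeldGoodTwists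

universe u

/-! ## §1 Shimura reciprocity read in `K[1] = H_K` -/

section Transport

variable {K : Type} [Field K] [NumberField K] {N : ℕ} [NeZero N] {W : WeierstrassCurve ℚ} [W.IsElliptic]

/-- Coercion to `ℂ` along an inclusion of subfields (generic in the subfields, so that the kernel never compares the two
carrier types). [folklore] -/
theorem coe_subfieldInclusion {S T : Subfield ℂ} (h : S ≤ T) (x : S) : ((Subfield.inclusion h x : T) : ℂ) = x := rfl

/-- `T ⊂ ℂ` after `S ⊆ T` is `S ⊂ ℂ`, as `ℚ`-algebra maps (generic in the subfields). [folklore] -/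
theorem toRatAlgHom_subtype_comp_inclusion' {S T : Subfield ℂ} (h : S ≤ T) :
    T.subtype.toRatAlgHom.comp (Subfield.inclusion h).toRatAlgHom = S.subtype.toRatAlgHom :=
  AlgHom.ext fun _ ↦ rfl

omit [NeZero N] [W.IsElliptic] in
/-- The complex point of the transport of `P ∈ E(S)` to `E(T)`, `S ⊆ T ⊂ ℂ`, is the complex point of `P` (generic in the
subfields). [folklore] -/
theorem map_subtype_map_inclusion' {S T : Subfield ℂ} (h : S ≤ T) (P : (W.baseChange S).toAffine.Point) :
    Affine.Point.map T.subtype.toRatAlgHom (Affine.Point.map (W' := W) (Subfield.inclusion h).toRatAlgHom P) =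
      Affine.Point.map S.subtype.toRatAlgHom P := by
  rw [Affine.Point.map_map, toRatAlgHom_subtype_comp_inclusion']

omit [NeZero N] [W.IsElliptic] in
/-- A `K`-automorphism and its restriction of scalars to `ℚ` act identically on points. [folklore] -/
theorem map_restrictScalars_eq {L : Type} [Field L] [Algebra K L] [CharZero L] [DecidableEq L] (σ : L ≃ₐ[K] L)
    (X : (W.baseChange L).toAffine.Point) :
    Affine.Point.map ((σ : L →ₐ[K] L).restrictScalars ℚ) X = Affine.Point.map (σ : L →ₐ[K] L) X := by
  cases X <;> rfl

/-- **Shimura reciprocity in `E(K[1])`** (Darmon Thm 3.6–3.7, the tree's PROVED `heegnerPoints_shimuraReciprocity_holds`, transported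
along `K[1] = H_K`, `ringClassField_one`): a lift family `P_Q ∈ E(K[1])` of the Heegner points `φ(τ_Q)`, `Q ∈ H.reps`, and an
isomorphism `Θ : Cl(𝒪_{d_K}) ≃ Gal(K[1]/K)` with `Θ(γ) P_Q = P_{Q'}`, `[𝔞_{Q'}] = γ[𝔞_Q]`.
[cite: Darmon2004, Thm. 3.6 and Thm. 3.7 (PDF pp. 41–44)] [cite: Cox2013, Thm. 11.1] -/
theorem exists_shimuraReciprocity_ringClassField_one (hK : IsImaginaryQuadratic K) (hH : SatisfiesHeegnerHypothesis N K)
    (Dt : ModularParametrizationData W N) (H : HeegnerDatum N (NumberField.discr K)) (ι : K →+* ℂ) :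
    ∃ (P : H.reps → (W.baseChange (ringClassField K ι 1)).toAffine.Point)
      (Θ : ClassGroup (OrderCl.QO hK.negDiscr) ≃* (ringClassField K ι 1 ≃ₐ[K] ringClassField K ι 1)),
      (∀ q : H.reps, Affine.Point.map (ringClassField K ι 1).subtype.toRatAlgHom (P q) = Dt.φ (heegnerTau q)) ∧
      ∀ (γ : ClassGroup (OrderCl.QO hK.negDiscr)) (q : H.reps), ∃ q' : H.reps,
        heegnerFormClass hK q' = γ * heegnerFormClass hK q ∧
        Affine.Point.map (Θ γ : ringClassField K ι 1 →ₐ[K] ringClassField K ι 1) (P q) = P q' := by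
  obtain ⟨P, θ, hP, hθ⟩ := heegnerPoints_shimuraReciprocity_holds N W K hK hH Dt H ι
  have hle : singularModuliField K ι ≤ ringClassField K ι 1 := (ringClassField_one ι).ge
  have hge : ringClassField K ι 1 ≤ singularModuliField K ι := (ringClassField_one ι).le
  -- the identification `e : H_K ≃ₐ[K] K[1]` (inclusions both ways; all identities through `coe_subfieldInclusion`)
  let f : singularModuliField K ι →ₐ[K] ringClassField K ι 1 :=
    { Subfield.inclusion hle with commutes' := fun k ↦ Subtype.ext rfl }
  let g : ringClassField K ι 1 →ₐ[K] singularModuliField K ι :=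
    { Subfield.inclusion hge with commutes' := fun k ↦ Subtype.ext rfl }
  have hf : ∀ x, ((f x : ringClassField K ι 1) : ℂ) = x := fun x ↦ coe_subfieldInclusion hle x
  have hg : ∀ y, ((g y : singularModuliField K ι) : ℂ) = y := fun y ↦ coe_subfieldInclusion hge y
  have hgf : ∀ x, g (f x) = x := fun x ↦ Subtype.ext ((hg (f x)).trans (hf x))
  have hfg : ∀ y, f (g y) = y := fun y ↦ Subtype.ext ((hf (g y)).trans (hg y))
  let e : singularModuliField K ι ≃ₐ[K] ringClassField K ι 1 :=
    AlgEquiv.ofAlgHom f g (AlgHom.ext hfg) (AlgHom.ext hgf)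
  -- the transported family, as images under the `ℚ`-algebra map `H_K → K[1]`
  refine ⟨fun q ↦ Affine.Point.map (Subfield.inclusion hle).toRatAlgHom (P q), θ.trans (AlgEquiv.autCongr e),
    fun q ↦ ?_, fun γ q ↦ ?_⟩
  · show Affine.Point.map (ringClassField K ι 1).subtype.toRatAlgHom
      (Affine.Point.map (Subfield.inclusion hle).toRatAlgHom (P q)) = _
    rw [map_subtype_map_inclusion' hle]
    exact hP q
  · obtain ⟨q', hq', hmap⟩ := hθ γ q
    refine ⟨q', hq', ?_⟩
    -- the two composites `H_K → K[1]` agree: `Θ(γ) ∘ incl = incl ∘ θ(γ)`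
    have hcomp : (((θ.trans (AlgEquiv.autCongr e) γ : ringClassField K ι 1 ≃ₐ[K] ringClassField K ι 1) :
        ringClassField K ι 1 →ₐ[K] ringClassField K ι 1).restrictScalars ℚ).comp (Subfield.inclusion hle).toRatAlgHom =
        (Subfield.inclusion hle).toRatAlgHom.comp (((θ γ : singularModuliField K ι ≃ₐ[K] singularModuliField K ι) :
          singularModuliField K ι →ₐ[K] singularModuliField K ι).restrictScalars ℚ) := by
      apply AlgHom.ext
      intro x
      show (AlgEquiv.autCongr e (θ γ)) (f x) = f ((θ γ) x)
      show e ((θ γ) (g (f x))) = f ((θ γ) x)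
      rw [hgf]
      rfl
    show Affine.Point.map ((θ.trans (AlgEquiv.autCongr e) γ : ringClassField K ι 1 ≃ₐ[K] ringClassField K ι 1) :
        ringClassField K ι 1 →ₐ[K] ringClassField K ι 1) (Affine.Point.map (Subfield.inclusion hle).toRatAlgHom (P q)) =
        Affine.Point.map (Subfield.inclusion hle).toRatAlgHom (P q')
    rw [← hmap, ← map_restrictScalars_eq (K := K) ((θ.trans (AlgEquiv.autCongr e)) γ),
      ← map_restrictScalars_eq (K := K) (θ γ) (P q), Affine.Point.map_map, Affine.Point.map_map, hcomp]

omit [W.IsElliptic] in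
/-- **`y(1)` belongs to the lifted family**: the conductor-`1` point `d.y ∈ E(K[1])` of a Kolyvagin–Heegner datum of `(Dt, β, ι)` maps
in `E(ℂ)` to `φ(τ_{q₁})` for a representative `q₁ ∈ H.reps` of any Heegner datum `H` with `H.β = β` (`x(1) = τ_{((β²−d_K)/4, β, 1)}`
is `Γ₀(N)`-equivalent to `τ_{q₁}`, and `φ` is `Γ₀(N)`-invariant). [cite: GrossLMS1991, §3 (x_1, y_1)] [cite: Gross1984, §I.1] -/
theorem exists_rep_map_y_eq_of_kolyvaginHeegnerData (hK : IsImaginaryQuadratic K) {Dt : ModularParametrizationData W N} {β : ℤ}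
    {ι : K →+* ℂ} (d : KolyvaginHeegnerData Dt β ι 1) (H : HeegnerDatum N (NumberField.discr K)) (hβ : H.β = β) :
    ∃ q₁ : H.reps, Affine.Point.map (ringClassField K ι 1).subtype.toRatAlgHom d.y = Dt.φ (heegnerTau q₁) := by
  obtain ⟨h1, h2⟩ := heegnerFormOfConductor_mem_heegnerForms (N := N) hK.discr_neg d.dvd_sq_sub one_ne_zero
  rw [Nat.cast_one, one_pow, one_mul] at h1
  rw [Nat.cast_one, one_mul] at h2
  obtain ⟨Q', hQ', γ, hγ⟩ := H.exists_isGamma0Equiv _ h1 (by rw [hβ]; exact h2)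
  refine ⟨⟨Q', hQ'⟩, ?_⟩
  rw [d.map_y]
  show Dt.φ (heegnerTau (heegnerFormOfConductor (NumberField.discr K) β 1)) = Dt.φ (heegnerTau Q')
  rw [← hγ, Dt.φ_gamma0_smul_holds' γ]

omit [W.IsElliptic] in
/-- **`y(1) = P_{q₁}` in `E(K[1])`** for the `K[1]`-lift family of `exists_shimuraReciprocity_ringClassField_one` (injectivity of
`E(K[1]) → E(ℂ)`). [cite: GrossLMS1991, §3 (y_1 ∈ E(K_1))] [cite: Darmon2004, Thm. 3.6] -/
theorem exists_rep_y_eq_of_kolyvaginHeegnerData (hK : IsImaginaryQuadratic K) {Dt : ModularParametrizationData W N} {β : ℤ}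
    {ι : K →+* ℂ} (d : KolyvaginHeegnerData Dt β ι 1) (H : HeegnerDatum N (NumberField.discr K)) (hβ : H.β = β)
    {P : H.reps → (W.baseChange (ringClassField K ι 1)).toAffine.Point}
    (hP : ∀ q : H.reps, Affine.Point.map (ringClassField K ι 1).subtype.toRatAlgHom (P q) = Dt.φ (heegnerTau q)) :
    ∃ q₁ : H.reps, d.y = P q₁ := by
  obtain ⟨q₁, hq₁⟩ := exists_rep_map_y_eq_of_kolyvaginHeegnerData hK d H hβ
  exact ⟨q₁, Affine.Point.map_injective (f := (ringClassField K ι 1).subtype.toRatAlgHom) (hq₁.trans (hP q₁).symm)⟩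

end Transport

/-! ## §3 The genus character on `Gal(L/K)`: `σ r₀ = r₀ ⟺ Θ⁻¹ σ` is a square (index `2`) -/

section GenusCharacter

variable {K : Type} [Field K] {L : Type u} [Field L] [Algebra K L]

/-- A `K`-automorphism sends a square root `r₀` of `d ∈ K` to `±r₀`. [folklore] -/
theorem algEquiv_apply_sqrt_eq_or {r₀ : L} {d : K} (hr : r₀ ^ 2 = algebraMap K L d) (σ : L ≃ₐ[K] L) :
    σ r₀ = r₀ ∨ σ r₀ = -r₀ := by
  apply sq_eq_sq_iff_eq_or_eq_neg.mp
  rw [← map_pow, hr, AlgEquiv.commutes]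

/-- The square of a `K`-automorphism fixes `r₀ = √d`. [folklore] -/
theorem algEquiv_sq_apply_sqrt {r₀ : L} {d : K} (hr : r₀ ^ 2 = algebraMap K L d) (σ : L ≃ₐ[K] L) :
    (σ ^ 2) r₀ = r₀ := by
  rw [sq, AlgEquiv.mul_apply]
  rcases algEquiv_apply_sqrt_eq_or hr σ with h | h
  · rw [h, h]
  · rw [h, map_neg, h, neg_neg]

variable [FiniteDimensional K L] [IsGalois K L]

/-- If `d` is not a square in `K` then some `σ ∈ Gal(L/K)` has `σ r₀ = −r₀` (`r₀ ∉ K = L^{Gal}`). [folklore] -/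
theorem exists_algEquiv_apply_sqrt_eq_neg {r₀ : L} {d : K} (hr : r₀ ^ 2 = algebraMap K L d) (hd : ¬ IsSquare d) :
    ∃ σ : L ≃ₐ[K] L, σ r₀ = -r₀ := by
  by_contra h
  push Not at h
  have hfix : ∀ σ : L ≃ₐ[K] L, σ r₀ = r₀ := fun σ ↦ (algEquiv_apply_sqrt_eq_or hr σ).resolve_right (h σ)
  obtain ⟨k, hk⟩ := (IsGalois.mem_bot_iff_fixed r₀).mpr hfix
  apply hd
  refine ⟨k, (algebraMap K L).injective ?_⟩
  rw [← hr, ← hk, map_mul, sq]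
  rfl

/-- **The genus character on the Galois side.** Let `Θ : G ≃* Gal(L/K)` with `G` commutative and `[G : G²] = 2`, and `r₀ ∈ L`,
`r₀² = d ∈ K` with `d` not a square in `K` (and `char ≠ 2`). Then `σ r₀ = r₀ ⟺ Θ⁻¹σ ∈ G²`: the squares fix `r₀`; conversely
the stabiliser of `r₀` contains `Θ(G²)`, misses some `σ₀`, and `[G : G²] = 2` leaves no room in between. For the Artin
isomorphism of the Hilbert class field this is «the genus field `K(√d)` is fixed exactly by the principal genus `Cl²`».
[cite: Cox2013, §3.B Thm. 3.15 and §6.A Thm. 6.1] -/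
theorem algEquiv_apply_sqrt_eq_iff_symm_mem_range_sq [CharZero L] {G : Type*} [CommGroup G]
    (Θ : G ≃* (L ≃ₐ[K] L)) (hidx : (powMonoidHom 2 : G →* G).range.index = 2)
    {r₀ : L} {d : K} (hr : r₀ ^ 2 = algebraMap K L d) (hd : ¬ IsSquare d) (σ : L ≃ₐ[K] L) :
    σ r₀ = r₀ ↔ Θ.symm σ ∈ (powMonoidHom 2 : G →* G).range := by
  -- squares fix `r₀`
  have hsq : ∀ g : G, g ∈ (powMonoidHom 2 : G →* G).range → (Θ g) r₀ = r₀ := by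
    rintro g ⟨δ, rfl⟩
    rw [powMonoidHom_apply, map_pow]
    exact algEquiv_sq_apply_sqrt hr (Θ δ)
  have hr0 : r₀ ≠ 0 := by
    rintro rfl
    apply hd
    refine ⟨0, (algebraMap K L).injective ?_⟩
    rw [← hr, map_mul, map_zero, mul_zero, zero_pow two_ne_zero]
  have hne : -r₀ ≠ r₀ := fun h ↦ hr0 (add_self_eq_zero.mp (neg_eq_iff_add_eq_zero.mp h))
  refine ⟨fun hσ ↦ ?_, fun h ↦ by simpa using hsq _ h⟩
  -- a `σ₀` moving `r₀`; its class is not a square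
  obtain ⟨σ₀, hσ₀⟩ := exists_algEquiv_apply_sqrt_eq_neg hr hd
  have h0 : Θ.symm σ₀ ∉ (powMonoidHom 2 : G →* G).range := by
    intro hmem
    have := hsq _ hmem
    rw [MulEquiv.apply_symm_apply, hσ₀] at this
    exact hne this
  by_contra hσ'
  -- index two: the product of two non-squares is a square, so `σ₀ σ⁻¹` fixes `r₀` — but it moves it
  have hprod : Θ.symm σ₀ * (Θ.symm σ)⁻¹ ∈ (powMonoidHom 2 : G →* G).range := by
    rw [Subgroup.mul_mem_iff_of_index_two hidx, Subgroup.inv_mem_iff]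
    exact ⟨fun h ↦ absurd h h0, fun h ↦ absurd h hσ'⟩
  have hfix := hsq _ hprod
  rw [map_mul, map_inv, MulEquiv.apply_symm_apply, MulEquiv.apply_symm_apply, AlgEquiv.mul_apply] at hfix
  have hinv : σ⁻¹ r₀ = r₀ := by
    have := congrArg (σ⁻¹ : L ≃ₐ[K] L) hσ
    rw [← AlgEquiv.mul_apply, inv_mul_cancel, AlgEquiv.one_apply] at this
    exact this.symm
  rw [hinv, hσ₀] at hfix
  exact hne hfix

end GenusCharacter

end Summit.BirchSwinnertonDyer.BirchSwinnertonDyer.Theorems.GoldfeldGoodTwists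

end
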